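import Summits.CriticalPhenomena.PercolationContinuityZ3.Theorems.PercAnnulusCrossingIICSchemeScales
import HarnessLib

/-!
# Kesten–Basu–Sapozhnikov IIC scheme in boxes at a GENERAL ASPECT, XVIII′: choice of scales with small junk (lane RSW3, p1 gen 4)

builds on p205010 (kernel theorem, internal audit signed; external expert review pending)

Seat `prim-rsw3-p1` (gen 4).  General-aspect companion of part XVIII (`PercAnnulusCrossingIICSchemeScales.lean`): the scales of Kesten's
scheme for (A2)□ with an abstract middle-sphere map `σ` and outer-radius map `τ` (`m < σ m < τ m` for `m ≥ 1`; `σ = (s·)`, `τ = (L·)` is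
`Crossing.SetToSetQuasiMultAspectAt d p s L ϰ`).  When `θ(p) = 0` the annulus-crossing probability `α(a,b) = P(Λ(a) ↔ ∂ⁱⁿΛ(b))` tends to `0`
as `b → ∞` (part II), so the scales can be chosen inside-out with every junk term `≤ δ`.  Helper file; no definitions, no sorries.
* **`exists_scheme_scales_aspect`** — for `θ(p) = 0`, `δ > 0`, `a₀, L`: scale functions `M1 M2 μ1 μ2` (scheme-level indexed, `0` outermost)
  with `1 ≤ M1 l ≤ M2 l`, `τ (M1 l) < σ (M2 l)`, `α(σ (M1 l), σ (M2 l)) ≤ δ` (`l ≤ L`), `τ (σ (M2 (l+1)) + 1) + 2 ≤ σ (μ1 l)`,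
  `τ (μ1 l) < σ (μ2 l)`, `μ2 l ≤ M1 l`, `α(σ (μ1 l), σ (μ2 l)) ≤ δ` (`l < L`), and `a₀ ≤ σ (M1 L)`.
References: H. Kesten, PTRF 73 (1986) §2; D. Basu, A. Sapozhnikov, ECP 22 (2017) no. 26, §2 (scales `N_{i+1} > 4 N_i`).
-/

noncomputable section

namespace Summit.CriticalPhenomena.PercolationContinuityZ3.Theorems.Crossing

open MeasureTheory Filter Topology Literature.Probability.Percolation Literature.Probability.LatticeModels
open Literature.Probability.Percolation.DCT16
open Summit.CriticalPhenomena.PercolationContinuityZ3.Theorems.SurfaceTension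
open scoped Literature.Probability.Percolation

variable {d : ℕ}

/-- **Scales for Kesten's scheme at a general aspect with junk `≤ δ`** (`θ(p) = 0`): see the module docstring. [cite: Kesten1986, §2] -/
theorem exists_scheme_scales_aspect (p : unitInterval) (hθ : theta (zdGraph d) 0 p = 0)
    {σ τ : ℕ → ℕ} (hσ : ∀ m : ℕ, 1 ≤ m → m < σ m) (hστ : ∀ m : ℕ, 1 ≤ m → σ m < τ m) {δ : ℝ} (hδ : 0 < δ) (a₀ L : ℕ) :
    ∃ M1 M2 μ1 μ2 : ℕ → ℕ,
      (∀ l ≤ L, 1 ≤ M1 l ∧ M1 l ≤ M2 l ∧ τ (M1 l) < σ (M2 l) ∧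
        (bondPercolation (zdGraph d) p).real (boxCrossing d (σ (M1 l)) (σ (M2 l))) ≤ δ) ∧
      (∀ l < L, τ (σ (M2 (l + 1)) + 1) + 2 ≤ σ (μ1 l) ∧ τ (μ1 l) < σ (μ2 l) ∧ μ2 l ≤ M1 l ∧
        (bondPercolation (zdGraph d) p).real (boxCrossing d (σ (μ1 l)) (σ (μ2 l))) ≤ δ) ∧
      a₀ ≤ σ (M1 L) := by
  set μ := bondPercolation (zdGraph d) p with hμ
  -- junk choice: for every `a` and lower bound `B` an index `b ≥ max B 1` with `α(a, σ b) ≤ δ`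
  have hjunk : ∀ a B : ℕ, ∃ b : ℕ, B ≤ b ∧ 1 ≤ b ∧ μ.real (boxCrossing d a (σ b)) ≤ δ := by
    intro a B
    have ht := tendsto_real_boxCrossing_of_theta_eq_zero (d := d) p hθ a
    obtain ⟨K, hK⟩ := eventually_atTop.1 ((tendsto_order.1 ht).2 δ hδ)
    refine ⟨max (max B K) 1, (le_max_left _ _).trans (le_max_left _ _), le_max_right _ _, (hK _ ?_).le⟩
    have h1 := hσ (max (max B K) 1) (le_max_right _ _)
    exact ((le_max_right _ _).trans (le_max_left _ _)).trans h1.le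
  -- construction-indexed scales (`j = 0` innermost)
  have build : ∀ J : ℕ, ∃ A1 A2 ν1 ν2 : ℕ → ℕ,
      (∀ j ≤ J, 1 ≤ A1 j ∧ A1 j ≤ A2 j ∧ τ (A1 j) < σ (A2 j) ∧ μ.real (boxCrossing d (σ (A1 j)) (σ (A2 j))) ≤ δ) ∧
      (∀ j < J, τ (σ (A2 j) + 1) + 2 ≤ σ (ν1 j) ∧ τ (ν1 j) < σ (ν2 j) ∧ ν2 j ≤ A1 (j + 1) ∧
        μ.real (boxCrossing d (σ (ν1 j)) (σ (ν2 j))) ≤ δ) ∧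
      a₀ ≤ σ (A1 0) := by
    intro J
    induction J with
    | zero =>
      obtain ⟨b, hb, hb1, hαb⟩ := hjunk (σ (a₀ + 1)) (τ (a₀ + 1) + 1)
      have h1 := hσ (a₀ + 1) (by omega)
      have h2 := hστ (a₀ + 1) (by omega)
      have h3 := hσ b hb1
      refine ⟨fun _ => a₀ + 1, fun _ => b, fun _ => 0, fun _ => 0, fun j hj => ?_,
        fun j hj => absurd hj (Nat.not_lt_zero _), ?_⟩
      · beta_reduce; exact ⟨by omega, by omega, by omega, hαb⟩
      · beta_reduce; omega
    | succ J ih =>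
      obtain ⟨A1, A2, ν1, ν2, hA, hν, h0⟩ := ih
      set c₁ : ℕ := τ (σ (A2 J) + 1) + 2 with hc₁
      obtain ⟨b1, hb1, hb11, hαb1⟩ := hjunk (σ c₁) (τ c₁ + 1)
      obtain ⟨b2, hb2, hb21, hαb2⟩ := hjunk (σ b1) (τ b1 + 1)
      have e1 := hσ c₁ (by omega)
      have e2 := hσ b1 hb11
      have e3 := hστ b1 hb11
      have e4 := hσ b2 hb21
      refine ⟨fun j => if j ≤ J then A1 j else b1, fun j => if j ≤ J then A2 j else b2,
        fun j => if j < J then ν1 j else c₁, fun j => if j < J then ν2 j else b1,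
        fun j hj => ?_, fun j hj => ?_, by beta_reduce; rw [if_pos (Nat.zero_le J)]; exact h0⟩
      · by_cases hjJ : j ≤ J
        · beta_reduce; rw [if_pos hjJ, if_pos hjJ]; exact hA j hjJ
        · beta_reduce; rw [if_neg hjJ, if_neg hjJ]
          exact ⟨hb11, by omega, by omega, hαb2⟩
      · by_cases hjJ : j < J
        · have h1 : j ≤ J := hjJ.le
          have h2 : j + 1 ≤ J := hjJ
          beta_reduce; rw [if_pos hjJ, if_pos hjJ, if_pos h1, if_pos h2]
          exact hν j hjJ
        · have hj' : j = J := by omega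
          subst hj'
          beta_reduce
          rw [if_neg (lt_irrefl j), if_neg (lt_irrefl j), if_pos (le_refl j), if_neg (show ¬ (j + 1 ≤ j) from by omega)]
          exact ⟨by omega, by omega, le_rfl, hαb1⟩
  obtain ⟨A1, A2, ν1, ν2, hA, hν, h0⟩ := build L
  refine ⟨fun l => A1 (L - l), fun l => A2 (L - l), fun l => ν1 (L - l - 1), fun l => ν2 (L - l - 1),
    fun l hl => hA (L - l) (by omega), fun l hl => ?_, by beta_reduce; rw [Nat.sub_self]; exact h0⟩
  have e1 : L - (l + 1) = L - l - 1 := by omega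
  have e2 : L - l - 1 + 1 = L - l := by omega
  obtain ⟨h1, h2, h3, h4⟩ := hν (L - l - 1) (by omega)
  beta_reduce
  rw [e1]
  rw [e2] at h3
  exact ⟨h1, h2, h3, h4⟩

end Summit.CriticalPhenomena.PercolationContinuityZ3.Theorems.Crossing

end
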